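import Summits.HodgeConjecture.HodgeConjecture.Theorems.R90S2ArchOrbitalProductOfWeilForm  -- ★ p864368 file (a): `IsArchProductFamily`, `orbitalIntegral_archTensor_eq_prod` (+ ★ `archProjAt`, `archPiEquivCM`)
import Summits.HodgeConjecture.HodgeConjecture.Theorems.R90S10ArchSignKitDefs          -- ★ `IsArchStablyNull`, `GInf`, `phi3` (+ ★ `ArchimedeanTransfer`: `archStableOrbitalIntegral`)
import HarnessLib

/-!
# R90-TF ∕ S2 «Ch. 12 archimedean block» — `R90S2ArchStableOrbitalProduct` (CARD 3, L-Π stable side): the STABLE orbital integral of a pure tensor on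
# `G_∞ = U(H)(L ⊗ ℝ) ≅ ∏_w U(σ_w H)(ℂ)` is the PRODUCT of the local stable orbital integrals; vanishing at ONE place gives ★ `IsArchStablyNull`

Cell `pub/hodgecm-mathlib`, Track B ∕ R90-TF, section S2, crux h413 = `stmt-HodgeConjecture-24833`, route `HCCMUnconditional`.  Prover K2E4-p23 (g4); CHAIR K2-lead (g2)
VALVE 12 (b); S2 desk K2E1b-plan (g8) HEADS-CARD3 + rulings 2026-09-05T01:45–01:51Z (interface of record = LH7-p07 (g2)'s `IsArchProductFamily`, file (a)
`R90S2ArchOrbitalProductOfWeilForm`; `open scoped Classical` for the `Fintype` of the complex places, as all S2 cards).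

PRINT → DECL (Rogawski 1990 §13.8, proof of Prop. 13.8.3, p. 218 L20–21 «`f = f_u ⊗ ⊗_{w ≠ u} f_{1,w}` with `f_u` such that the stable orbital integrals of `f_u`
vanish»; §4.1 (4.1.1) p. 39 `Φ^st(γ, f) = Σ Φ(γ′, f)`; §14.2 p. 232 (orbital integrals of product functions are products); §3.1 p. 19):
* §0 `finsum_mem_univ_pi_prod` — `∑ᶠ_{x ∈ ∏_i T_i} ∏_i F_i(x_i) = ∏_i ∑ᶠ_{y ∈ T_i} F_i(y)` over a finite index type, NO finiteness hypothesis (junk-consistent);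
* §1 `isStablyConj_arch_iff` — STABLE CONJUGACY IN `U(H)(L ⊗ ℝ)` IS PLACE-BY-PLACE (★ `IsStablyConj (c ⊗ 1) (H ⊗ 1)` = `GL_N(L ⊗ ℝ)`-conjugacy ↔ ∀ `w`, ★ LETTER #4 §5
  currency `IsStablyConj (starRingEnd ℂ) (σ_w H)` = `GL_N(ℂ)`-conjugacy of the components; transport along ★ `GLnMixedPiEquiv`, no real places on a CM field);
  `isConj_arch_iff` — plain conjugacy is place-by-place too (★ `archPiEquivCM`);
* §2 `archLocalStableOrbitalIntegral` — `Φ^st_w(γ_w, a)` on the factor `U(σ_w H)(ℂ)` (★ `stableOrbitalIntegralRel`; one-place twin of ★ `archStableOrbitalIntegral`);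
* §3 `bijOn_conjClassesPlaces` — classes inside the stable class of `γ` ↔ tuples of local classes inside the local stable classes of the `γ_w` (★ `archProjAt`);
  MAIN `archStableOrbitalIntegral_eq_prod_of_classOrbitalIntegral` — HYPOTHESIS-FIRST over the class-level product formula `hprod` ON THE STABLE CLASS OF `γ`
  (HEADS amendment A′ 02:00:42Z: local families are producible per stable class only) = the BODY of file (a)'s interface `IsArchProductFamily H (· ∼st γ) mG mLoc`
  at a pure tensor: `Φ^st_∞(γ, f) = ∏_w Φ^st_w(γ_w, φ_w)`; BY NAME `archStableOrbitalIntegral_eq_prod (hm : IsArchProductFamily H P mG mLoc) (hf) (γ) (hP)`;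
* §4 `isArchStablyNull_of_place` — CONSUMER COROLLARY on the block carrier `GInf L = U(Φ₃)(L ⊗ ℝ)`: per regular `γ` a tied `mLoc` (under `∃`) with local stable
  nullity of `φ_u` at the ONE local class `γ_u` ⇒ ★ `IsArchStablyNull L mG f` (p. 218 L20–21; the conjunct T2 (g) of the S2∕S10 assembly consumes).

HONESTY.  ZERO `sorry`; ★-only imports; no instance, no notation, no socket; default heartbeats.  NOTHING printed is paid here (group∕`finsum` book-keeping): the
class-level product formula is a HYPOTHESIS (`hprod` ∕ `IsArchProductFamily`, paid measure-theoretically on file (a)'s road); local stable nullity of `f_{1u} − f_{2u}`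
is letter ℓ4 (Shelstad ∕ Prop. 12.3.2).  HC_CM is proved only modulo the 7 printed citations (2 remaining named inputs: hLiu418 = stmt-HodgeConjecture-24832, h413 =
stmt-HodgeConjecture-24833) until rung 0 closes.  Count-neutral helper (`--supports stmt-HodgeConjecture-24833`).

References: [cite: Rogawski1990, §13.8 Prop. 13.8.3 (proof) p. 218; §4.1 (4.1.1) p. 39; §14.2 p. 232; §3.1 p. 19] [cite: BorelJacquet1979, §4.1] [cite: PlatonovRapinchuk1994, §2.3]
-/

set_option autoImplicit false
set_option linter.dupNamespace false

noncomputable section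

open MeasureTheory NumberField NumberField.InfinitePlace
open scoped Matrix MatrixGroups Classical
open Literature.NumberTheory.Automorphic Literature.NumberTheory.Automorphic.UnitaryGroup
open Literature.NumberTheory.Rogawski1990

namespace Summit.HodgeConjecture.HodgeConjecture.R90.S2

/-! ## §0 The `finsum`–product exchange over a finite product of index sets (no finiteness hypothesis) -/

/-- **`∑ᶠ_{x ∈ ∏_i T_i} ∏_i F_i(x_i) = ∏_i ∑ᶠ_{y ∈ T_i} F_i(y)`** for a finite index type `ι`, arbitrary index sets `T_i` and values in a commutative semiring
without zero divisors.  No finiteness is assumed: if every `T_i ∩ support F_i` is finite this is `Finset.prod_univ_sum`; if one of them is infinite its `finsum`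
factor is `0`, and the left side is `0` too — either some other factor has EMPTY `T_j ∩ support F_j` (the integrand vanishes on the box) or the support of the
integrand inside the box, `∏_i (T_i ∩ support F_i)`, is infinite. [folklore] -/
theorem finsum_mem_univ_pi_prod {ι : Type*} [Fintype ι] {α : ι → Type*} {R : Type*} [CommSemiring R] [NoZeroDivisors R] [Nontrivial R]
    (T : ∀ i, Set (α i)) (F : ∀ i, α i → R) :
    ∑ᶠ x ∈ Set.pi Set.univ T, ∏ i, F i (x i) = ∏ i, ∑ᶠ y ∈ T i, F i y := by
  -- the support of the integrand inside the box is the box of the supports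
  have hsupp : Set.pi Set.univ T ∩ Function.support (fun x : ∀ i, α i => ∏ i, F i (x i)) =
      Set.pi Set.univ (fun i => T i ∩ Function.support (F i)) := by
    ext x
    simp only [Set.mem_inter_iff, Set.mem_univ_pi, Function.mem_support, Finset.prod_ne_zero_iff, Finset.mem_univ,
      true_imp_iff]
    exact ⟨fun h i => ⟨h.1 i, h.2 i⟩, fun h => ⟨fun i => (h i).1, fun i => (h i).2⟩⟩
  by_cases hfin : ∀ i, (T i ∩ Function.support (F i)).Finite
  · -- every factor is a finite sum: `Finset.prod_univ_sum`
    have hR : ∀ i, ∑ᶠ y ∈ T i, F i y = ∑ y ∈ (hfin i).toFinset, F i y := fun i => finsum_mem_eq_sum (F i) (hfin i)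
    have hL : Set.pi Set.univ T ∩ Function.support (fun x : ∀ i, α i => ∏ i, F i (x i)) =
        ↑(Fintype.piFinset fun i => (hfin i).toFinset) := by
      rw [hsupp]
      ext x
      simp only [Set.mem_univ_pi, Fintype.coe_piFinset, Set.Finite.coe_toFinset]
    calc ∑ᶠ x ∈ Set.pi Set.univ T, ∏ i, F i (x i)
        = ∑ᶠ x ∈ Set.pi Set.univ T ∩ Function.support (fun x : ∀ i, α i => ∏ i, F i (x i)), ∏ i, F i (x i) :=
          (finsum_mem_inter_support _ _).symm
      _ = ∑ x ∈ Fintype.piFinset (fun i => (hfin i).toFinset), ∏ i, F i (x i) := by rw [hL, finsum_mem_coe_finset]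
      _ = ∏ i, ∑ y ∈ (hfin i).toFinset, F i y := (Finset.prod_univ_sum _ _).symm
      _ = ∏ i, ∑ᶠ y ∈ T i, F i y := Finset.prod_congr rfl fun i _ => (hR i).symm
  · -- one factor is an infinite sum, hence `0`; the left side is `0` as well
    obtain ⟨i₀, hi₀⟩ := not_forall.1 hfin
    have hR0 : ∑ᶠ y ∈ T i₀, F i₀ y = 0 := finsum_mem_eq_zero_of_infinite hi₀
    rw [Finset.prod_eq_zero (Finset.mem_univ i₀) hR0]
    by_cases hne : ∀ i, (T i ∩ Function.support (F i)).Nonempty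
    · -- the support of the integrand inside the box is infinite
      apply finsum_mem_eq_zero_of_infinite
      rw [hsupp]
      choose x₀ hx₀ using hne
      refine Set.infinite_of_injOn_mapsTo (f := fun y : α i₀ => Function.update x₀ i₀ y) ?_ ?_ hi₀
      · intro y _ y' _ h
        have h' := congrFun h i₀
        simpa only [Function.update_self] using h'
      · intro y hy
        rw [Set.mem_univ_pi]
        intro i
        by_cases hi : i = i₀
        · subst hi
          simpa only [Function.update_self] using hy
        · change Function.update x₀ i₀ y i ∈ _
          rw [Function.update_of_ne hi]
          exact hx₀ i
    · -- some factor vanishes identically on the box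
      obtain ⟨j, hj⟩ := not_forall.1 hne
      apply finsum_mem_of_eqOn_zero
      intro x hx
      have hxj : x j ∈ T j := (Set.mem_univ_pi.1 hx) j
      have hFj : F j (x j) = 0 := by
        by_contra h
        exact hj ⟨x j, hxj, h⟩
      exact Finset.prod_eq_zero (Finset.mem_univ j) hFj

/-! ## §1 Stable conjugacy (and conjugacy) in `U(H)(L ⊗ ℝ)` is place-by-place -/

section PlaceByPlace

variable (L : Type) [Field L] [NumberField L] [IsCMField L] {N : ℕ} (H : Matrix (Fin N) (Fin N) L)

/-- **Stable conjugacy in `G_∞ = U(H)(L ⊗ ℝ)` is checked place by place**: `γ ∼st δ` (★ `IsStablyConj (c ⊗ 1) (H ⊗ 1)`, i.e. conjugacy in `GL_N(L ⊗ ℝ)`) iff for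
every complex place `w` the components `γ_w ∼st δ_w` in `U(σ_w H)(ℂ)` (★ LETTER #4 §5 currency: conjugacy in `GL_N(ℂ)`).  Forward: apply `GL_N(ev_w)`; backward:
glue the local conjugators through ★ `GLnMixedPiEquiv : GL_N(L ⊗ ℝ) ≃ ∏_w GL_N(ℂ)` (a CM field has no real place).
[cite: Rogawski1990, §3.1 p. 19; §14.2 p. 232] [cite: PlatonovRapinchuk1994, §2.3] -/
theorem isStablyConj_arch_iff (γ δ : ↥(arch (↥(maximalRealSubfield L)) L (IsCMField.complexConj L) N H)) :
    IsStablyConj (conjMixed (↥(maximalRealSubfield L)) L (IsCMField.complexConj L)) (archFormOf L N H) γ δ ↔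
      ∀ w : {w : InfinitePlace L // w.IsComplex},
        IsStablyConj (starRingEnd ℂ) (H.map w.1.embedding) (archPiEquivCM N L H γ w) (archPiEquivCM N L H δ w) := by
  constructor
  · intro h w
    obtain ⟨g, hg⟩ := isStablyConj_iff.1 h
    refine isStablyConj_iff.2 ⟨Matrix.GeneralLinearGroup.map (evalC L w) g, ?_⟩
    change Matrix.GeneralLinearGroup.map (evalC L w) g *
        Matrix.GeneralLinearGroup.map (evalC L w) (γ : GL (Fin N) (mixedEmbedding.mixedSpace L)) *
          (Matrix.GeneralLinearGroup.map (evalC L w) g)⁻¹ =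
      Matrix.GeneralLinearGroup.map (evalC L w) (δ : GL (Fin N) (mixedEmbedding.mixedSpace L))
    rw [← map_inv, ← map_mul, ← map_mul, hg]
  · intro h
    choose u hu using fun w => isStablyConj_iff.1 (h w)
    refine isStablyConj_iff.2
      ⟨(GLnMixedPiEquiv (↥(maximalRealSubfield L)) L (IsCMField.complexConj L) N (IsCMField.complexConj_ne_one L)
          (UnitaryGroup.complexConj_smul_infinitePlace L)).symm u,
        (GLnMixedPiEquiv (↥(maximalRealSubfield L)) L (IsCMField.complexConj L) N (IsCMField.complexConj_ne_one L)
          (UnitaryGroup.complexConj_smul_infinitePlace L)).injective ?_⟩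
    rw [map_mul, map_mul, map_inv, ContinuousMulEquiv.apply_symm_apply]
    funext w
    rw [Pi.mul_apply, Pi.mul_apply, Pi.inv_apply, GLnMixedPiEquiv_apply, GLnMixedPiEquiv_apply]
    exact hu w

/-- Read-back of `isStablyConj_arch_iff`, local currency unfolded: `γ ∼st δ` iff the components are `GL_N(ℂ)`-conjugate at every place. [cite: Rogawski1990, §3.1 p. 19] -/
theorem isStablyConj_arch_iff_forall_isConj (γ δ : ↥(arch (↥(maximalRealSubfield L)) L (IsCMField.complexConj L) N H)) :
    IsStablyConj (conjMixed (↥(maximalRealSubfield L)) L (IsCMField.complexConj L)) (archFormOf L N H) γ δ ↔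
      ∀ w : {w : InfinitePlace L // w.IsComplex},
        IsConj ((archPiEquivCM N L H γ w : ↥(archLocal L N H w)) : GL (Fin N) ℂ)
          ((archPiEquivCM N L H δ w : ↥(archLocal L N H w)) : GL (Fin N) ℂ) :=
  isStablyConj_arch_iff L H γ δ

/-- **Conjugacy in `G_∞` is place-by-place** along ★ `archPiEquivCM : U(H)(L ⊗ ℝ) ≃ₜ* ∏_w U(σ_w H)(ℂ)`. [cite: BorelJacquet1979, §4.1] -/
theorem isConj_arch_iff (γ δ : ↥(arch (↥(maximalRealSubfield L)) L (IsCMField.complexConj L) N H)) :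
    IsConj γ δ ↔ ∀ w : {w : InfinitePlace L // w.IsComplex}, IsConj (archPiEquivCM N L H γ w) (archPiEquivCM N L H δ w) := by
  constructor
  · exact fun h w => (archProjAt H w).map_isConj h
  · intro h
    choose u hu using fun w => isConj_iff.1 (h w)
    refine isConj_iff.2 ⟨(archPiEquivCM N L H).symm u, (archPiEquivCM N L H).injective ?_⟩
    rw [map_mul, map_mul, map_inv, ContinuousMulEquiv.apply_symm_apply]
    funext w
    exact hu w

end PlaceByPlace

/-! ## §2 The local stable orbital integral on `U(σ_w H)(ℂ)` -/

section Local

variable (L : Type) [Field L] [NumberField L] [IsCMField L] {N : ℕ} (H : Matrix (Fin N) (Fin N) L)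
  (w : {w : InfinitePlace L // w.IsComplex})

/-- **`Φ^st_w(γ_w, a)`** — the stable orbital integral on the local archimedean factor `U(σ_w H)(ℂ) = archLocal L N H w`: the `finsum`, over the conjugacy classes
of `U(σ_w H)(ℂ)` stably conjugate to `γ_w` (★ LETTER #4 §5 currency `IsStablyConj (starRingEnd ℂ) (σ_w H)` = conjugacy in `GL_N(ℂ)`), of the class orbital
integrals of `a` against the local family `mw` ((4.1.1) with `κ` trivial; the one-place twin of ★ `archStableOrbitalIntegral`).  At a DEFINITE place it is a single
class orbital integral (★ `archLocal_stableOrbitalIntegralRel_eq_classOrbitalIntegral_of_posDef`). [cite: Rogawski1990, §4.1 (4.1.1) p. 39; §14.2 p. 232] -/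
abbrev archLocalStableOrbitalIntegral
    {_hγw : ∀ γ : ↥(archLocal L N H w), MeasurableSpace (↥(archLocal L N H w) ⧸ Subgroup.centralizer ({γ} : Set ↥(archLocal L N H w)))}
    (mw : OrbitalMeasureFamily ↥(archLocal L N H w)) (a : ↥(archLocal L N H w) → ℂ) (γw : ↥(archLocal L N H w)) : ℂ :=
  stableOrbitalIntegralRel (G := ↥(archLocal L N H w)) (IsStablyConj (starRingEnd ℂ) (H.map w.1.embedding)) mw a γw

omit [NumberField L] [IsCMField L] in
/-- Unfolding of `archLocalStableOrbitalIntegral` (definitional). [cite: Rogawski1990, §4.1 (4.1.1) p. 39] -/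
theorem archLocalStableOrbitalIntegral_def
    {_hγw : ∀ γ : ↥(archLocal L N H w), MeasurableSpace (↥(archLocal L N H w) ⧸ Subgroup.centralizer ({γ} : Set ↥(archLocal L N H w)))}
    (mw : OrbitalMeasureFamily ↥(archLocal L N H w)) (a : ↥(archLocal L N H w) → ℂ) (γw : ↥(archLocal L N H w)) :
    archLocalStableOrbitalIntegral L H w mw a γw =
      ∑ᶠ c ∈ {c : ConjClasses ↥(archLocal L N H w) | IsStablyConj (starRingEnd ℂ) (H.map w.1.embedding) γw (Quotient.out c)},
        classOrbitalIntegral mw a c :=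
  rfl

end Local

/-! ## §3 The stable orbital integral of a pure tensor is the product of the local stable orbital integrals -/

section Product

variable (L : Type) [Field L] [NumberField L] [IsCMField L] {N : ℕ} (H : Matrix (Fin N) (Fin N) L)

/-- **The classes inside a stable class are tuples of local classes inside the local stable classes.**  The place-projection of conjugacy classes
`c ↦ (w ↦ (archProjAt H w)_* c)` is a bijection from the conjugacy classes of `G_∞` stably conjugate to `γ` onto the tuples `(c_w)_w` of conjugacy classes of the
`U(σ_w H)(ℂ)` with `c_w` stably conjugate to `γ_w` — conjugacy (`isConj_arch_iff`) and stable conjugacy (`isStablyConj_arch_iff`) are both place-by-place.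
[cite: Rogawski1990, §3.1 p. 19; §14.2 p. 232] [cite: BorelJacquet1979, §4.1] -/
theorem bijOn_conjClassesPlaces (γ : ↥(arch (↥(maximalRealSubfield L)) L (IsCMField.complexConj L) N H)) :
    Set.BijOn
      (fun (c : ConjClasses ↥(arch (↥(maximalRealSubfield L)) L (IsCMField.complexConj L) N H))
          (w : {w : InfinitePlace L // w.IsComplex}) => ConjClasses.map (archProjAt H w) c)
      {c | IsStablyConj (conjMixed (↥(maximalRealSubfield L)) L (IsCMField.complexConj L)) (archFormOf L N H) γ (Quotient.out c)}
      (Set.pi Set.univ fun w =>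
        {cw : ConjClasses ↥(archLocal L N H w) |
          IsStablyConj (starRingEnd ℂ) (H.map w.1.embedding) (archPiEquivCM N L H γ w) (Quotient.out cw)}) := by
  -- book-keeping on representatives: `⟦out c⟧ = c`, and `(out c)_w ∼ out ((archProjAt H w)_* c)`
  have hout : ∀ c : ConjClasses ↥(arch (↥(maximalRealSubfield L)) L (IsCMField.complexConj L) N H),
      ConjClasses.mk (Quotient.out c) = c := fun c => Quotient.out_eq c
  have houtw : ∀ (w : {w : InfinitePlace L // w.IsComplex}) (cw : ConjClasses ↥(archLocal L N H w)),
      ConjClasses.mk (Quotient.out cw) = cw := fun w cw => Quotient.out_eq cw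
  have hmo : ∀ (w : {w : InfinitePlace L // w.IsComplex})
      (c : ConjClasses ↥(arch (↥(maximalRealSubfield L)) L (IsCMField.complexConj L) N H)),
      IsConj (archProjAt H w (Quotient.out c)) (Quotient.out (ConjClasses.map (archProjAt H w) c)) := fun w c => by
    have e1 : ConjClasses.mk (archProjAt H w (Quotient.out c)) = ConjClasses.mk (Quotient.out (ConjClasses.map (archProjAt H w) c)) :=
      (congrArg (ConjClasses.map (archProjAt H w)) (hout c)).trans (houtw w _).symm
    exact ConjClasses.mk_eq_mk_iff_isConj.1 e1
  -- local stable conjugacy is invariant under conjugacy of the second argument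
  have hstw : ∀ (w : {w : InfinitePlace L // w.IsComplex}) (x y z : ↥(archLocal L N H w)),
      IsStablyConj (starRingEnd ℂ) (H.map w.1.embedding) x y → IsConj y z →
        IsStablyConj (starRingEnd ℂ) (H.map w.1.embedding) x z :=
    fun w x y z h hc => h.trans (isStablyConj_of_isConj hc)
  refine ⟨?_, ?_, ?_⟩
  · -- MapsTo
    intro c hc
    rw [Set.mem_univ_pi]
    intro w
    have hloc := (isStablyConj_arch_iff L H γ (Quotient.out c)).1 hc w
    change IsStablyConj (starRingEnd ℂ) (H.map w.1.embedding) (archPiEquivCM N L H γ w)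
      (Quotient.out (ConjClasses.map (archProjAt H w) c))
    exact hstw w _ _ _ hloc (hmo w c)
  · -- InjOn (in fact injective on all classes: conjugacy is place-by-place)
    intro c _ c' _ h
    have key : ∀ w : {w : InfinitePlace L // w.IsComplex},
        IsConj (archPiEquivCM N L H (Quotient.out c) w) (archPiEquivCM N L H (Quotient.out c') w) := fun w => by
      have hw : ConjClasses.map (archProjAt H w) c = ConjClasses.map (archProjAt H w) c' := congrFun h w
      have h1 := hmo w c
      have h2 := hmo w c'
      rw [hw] at h1
      exact h1.trans h2.symm
    exact (hout c).symm.trans ((ConjClasses.mk_eq_mk_iff_isConj.2 ((isConj_arch_iff L H _ _).2 key)).trans (hout c'))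
  · -- SurjOn: glue the representatives along `archPiEquivCM`
    intro d hd
    rw [Set.mem_univ_pi] at hd
    refine ⟨ConjClasses.mk ((archPiEquivCM N L H).symm fun w => Quotient.out (d w)), ?_, ?_⟩
    · change IsStablyConj (conjMixed (↥(maximalRealSubfield L)) L (IsCMField.complexConj L)) (archFormOf L N H) γ
        (Quotient.out (ConjClasses.mk ((archPiEquivCM N L H).symm fun w => Quotient.out (d w))))
      have hst : IsStablyConj (conjMixed (↥(maximalRealSubfield L)) L (IsCMField.complexConj L)) (archFormOf L N H) γ
          ((archPiEquivCM N L H).symm fun w => Quotient.out (d w)) := by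
        refine (isStablyConj_arch_iff L H γ _).2 fun w => ?_
        rw [ContinuousMulEquiv.apply_symm_apply]
        exact hd w
      exact hst.trans (isStablyConj_of_isConj (ConjClasses.mk_eq_mk_iff_isConj.1 (hout _).symm))
    · funext w
      change ConjClasses.mk (archPiEquivCM N L H ((archPiEquivCM N L H).symm fun w => Quotient.out (d w)) w) = d w
      rw [ContinuousMulEquiv.apply_symm_apply]
      exact houtw w (d w)

/-- **MAIN (hypothesis-first): `Φ^st_∞(γ, f) = ∏_w Φ^st_w(γ_w, φ_w)`.**  If the class orbital integrals of `f` on `G_∞ = U(H)(L ⊗ ℝ)` FACTOR over the complex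
places ON THE STABLE CLASS OF `γ` — `hprod`, quantified AFTER `γ` (HEADS amendment A′, S2 desk 2026-09-05T02:00:42Z: the orbital measures of record are tied to
product measures only up to a scalar constant on STABLE classes, so the local families `mLoc` are producible per stable class, not uniformly); this is the BODY of
file (a)'s interface `IsArchProductFamily H (· ∼st γ) mG mLoc` at a pure tensor `f = ⊗_w φ_w` (print: the orbital integral of a product function is the product of
the local ones) — then the STABLE orbital integral at `γ` factors: the classes stably conjugate to `γ` are the tuples of local classes stably conjugate to the `γ_w`
(`bijOn_conjClassesPlaces`) and `∑ ∏ = ∏ ∑` (`finsum_mem_univ_pi_prod`, no finiteness needed).  No regularity hypothesis is needed at this level.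
[cite: Rogawski1990, §4.1 (4.1.1) p. 39; §14.2 p. 232; §3.1 p. 19] -/
theorem archStableOrbitalIntegral_eq_prod_of_classOrbitalIntegral
    {_hγ : ∀ γ : ↥(arch (↥(maximalRealSubfield L)) L (IsCMField.complexConj L) N H),
      MeasurableSpace (↥(arch (↥(maximalRealSubfield L)) L (IsCMField.complexConj L) N H) ⧸ Subgroup.centralizer ({γ} : Set _))}
    {_hγw : ∀ (w : {w : InfinitePlace L // w.IsComplex}) (γ : ↥(archLocal L N H w)),
      MeasurableSpace (↥(archLocal L N H w) ⧸ Subgroup.centralizer ({γ} : Set ↥(archLocal L N H w)))}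
    (mG : OrbitalMeasureFamily ↥(arch (↥(maximalRealSubfield L)) L (IsCMField.complexConj L) N H))
    (mLoc : ∀ w : {w : InfinitePlace L // w.IsComplex}, OrbitalMeasureFamily ↥(archLocal L N H w))
    (f : ↥(arch (↥(maximalRealSubfield L)) L (IsCMField.complexConj L) N H) → ℂ)
    (φ : ∀ w : {w : InfinitePlace L // w.IsComplex}, ↥(archLocal L N H w) → ℂ)
    (γ : ↥(arch (↥(maximalRealSubfield L)) L (IsCMField.complexConj L) N H))
    (hprod : ∀ γ' : ↥(arch (↥(maximalRealSubfield L)) L (IsCMField.complexConj L) N H),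
      IsStablyConj (conjMixed (↥(maximalRealSubfield L)) L (IsCMField.complexConj L)) (archFormOf L N H) γ' γ →
        classOrbitalIntegral mG f (ConjClasses.mk γ') =
          ∏ w, classOrbitalIntegral (mLoc w) (φ w) (ConjClasses.map (archProjAt H w) (ConjClasses.mk γ'))) :
    archStableOrbitalIntegral L N H mG f γ =
      ∏ w, archLocalStableOrbitalIntegral L H w (mLoc w) (φ w) (archPiEquivCM N L H γ w) := by
  -- (b): each summand factors, by `hprod` at the representative of a class stably conjugate to `γ`
  have hpt : ∀ c ∈ {c : ConjClasses ↥(arch (↥(maximalRealSubfield L)) L (IsCMField.complexConj L) N H) |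
      IsStablyConj (conjMixed (↥(maximalRealSubfield L)) L (IsCMField.complexConj L)) (archFormOf L N H) γ (Quotient.out c)},
      classOrbitalIntegral mG f c = ∏ w, classOrbitalIntegral (mLoc w) (φ w) (ConjClasses.map (archProjAt H w) c) := by
    intro c hc
    have h := hprod (Quotient.out c) (IsStablyConj.symm hc)
    rw [show ConjClasses.mk (Quotient.out c) = c from Quotient.out_eq c] at h
    exact h
  -- (a): transport the index set along the place-projection of classes; (c): `∑ ∏ = ∏ ∑`
  have step := finsum_mem_eq_of_bijOn (f := fun c => classOrbitalIntegral mG f c)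
    (g := fun d : ∀ w : {w : InfinitePlace L // w.IsComplex}, ConjClasses ↥(archLocal L N H w) =>
      ∏ w, classOrbitalIntegral (mLoc w) (φ w) (d w))
    (fun (c : ConjClasses ↥(arch (↥(maximalRealSubfield L)) L (IsCMField.complexConj L) N H))
        (w : {w : InfinitePlace L // w.IsComplex}) => ConjClasses.map (archProjAt H w) c)
    (bijOn_conjClassesPlaces L H γ) hpt
  rw [archStableOrbitalIntegral, stableOrbitalIntegralRel_def]
  refine step.trans ?_
  simp only [archLocalStableOrbitalIntegral_def]
  exact finsum_mem_univ_pi_prod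
    (fun w : {w : InfinitePlace L // w.IsComplex} =>
      {cw : ConjClasses ↥(archLocal L N H w) |
        IsStablyConj (starRingEnd ℂ) (H.map w.1.embedding) (archPiEquivCM N L H γ w) (Quotient.out cw)})
    (fun w cw => classOrbitalIntegral (mLoc w) (φ w) cw)

/-- **BY NAME: `Φ^st_∞(γ, f) = ∏_w Φ^st_w(γ_w, φ_w)` for a pure tensor `f = ⊗_w φ_w`** (`hf`, the shape of ★ CARD 2 `archTensor_apply`) and families tied by ★ file (a)'s
`IsArchProductFamily H P mG mLoc` on any guard `P` containing the stable class of `γ` (`hP`; consumers take `P := (· ∼st γ)`, cf. ★ `IsArchProductFamily.mono`) —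
the MAIN lemma fed with ★ `orbitalIntegral_archTensor_eq_prod`. [cite: Rogawski1990, §4.1 (4.1.1) p. 39; §14.2 p. 232] -/
theorem archStableOrbitalIntegral_eq_prod
    {_hγ : ∀ γ : ↥(arch (↥(maximalRealSubfield L)) L (IsCMField.complexConj L) N H),
      MeasurableSpace (↥(arch (↥(maximalRealSubfield L)) L (IsCMField.complexConj L) N H) ⧸ Subgroup.centralizer ({γ} : Set _))}
    {_hγw : ∀ (w : {w : InfinitePlace L // w.IsComplex}) (γ : ↥(archLocal L N H w)),
      MeasurableSpace (↥(archLocal L N H w) ⧸ Subgroup.centralizer ({γ} : Set ↥(archLocal L N H w)))}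
    {P : ↥(arch (↥(maximalRealSubfield L)) L (IsCMField.complexConj L) N H) → Prop}
    {mG : OrbitalMeasureFamily ↥(arch (↥(maximalRealSubfield L)) L (IsCMField.complexConj L) N H)}
    {mLoc : ∀ w : {w : InfinitePlace L // w.IsComplex}, OrbitalMeasureFamily ↥(archLocal L N H w)}
    (hm : IsArchProductFamily H P mG mLoc)
    {f : ↥(arch (↥(maximalRealSubfield L)) L (IsCMField.complexConj L) N H) → ℂ}
    {φ : ∀ w : {w : InfinitePlace L // w.IsComplex}, ↥(archLocal L N H w) → ℂ}
    (hf : ∀ g, f g = ∏ w, φ w (archPiEquivCM N L H g w))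
    (γ : ↥(arch (↥(maximalRealSubfield L)) L (IsCMField.complexConj L) N H))
    (hP : ∀ γ' : ↥(arch (↥(maximalRealSubfield L)) L (IsCMField.complexConj L) N H),
      IsStablyConj (conjMixed (↥(maximalRealSubfield L)) L (IsCMField.complexConj L)) (archFormOf L N H) γ' γ → P γ') :
    archStableOrbitalIntegral L N H mG f γ =
      ∏ w, archLocalStableOrbitalIntegral L H w (mLoc w) (φ w) (archPiEquivCM N L H γ w) :=
  archStableOrbitalIntegral_eq_prod_of_classOrbitalIntegral L H mG mLoc f φ γ
    fun γ' hγ' => orbitalIntegral_archTensor_eq_prod H hm hf γ' (hP γ' hγ')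

end Product

/-! ## §4 Consumer corollary on the block carrier `G_∞ = U(Φ₃)(L ⊗ ℝ)`: vanishing at ONE place ⇒ ★ `IsArchStablyNull` -/

section Block

variable (L : Type) [Field L] [NumberField L] [IsCMField L]

/-- **p. 218 L20–21: local stable nullity at ONE place `u` ⇒ ★ `IsArchStablyNull`.**  Let `f = ⊗_w φ_w` be a pure tensor on `G_∞ = U(Φ₃)(L ⊗ ℝ)` (`hf`).  Suppose
that for every REGULAR `γ` there are local orbital-measure families `mLoc` (depending on the stable class of `γ` — HEADS amendment A′: the payer, file (a)'s FILE 2∕3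
road, produces them per stable class from the (W)(C)-normalised global family) tied to `mG` on the stable class of `γ` (★ `IsArchProductFamily (phi3 L) (· ∼st γ) mG mLoc`)
and such that the local STABLE orbital integral of the factor `φ_u` vanishes at the ONE local class `γ_u`.  Then every stable orbital integral of `f` at a regular
element vanishes: ★ `IsArchStablyNull L mG f` — the conjunct T2 (g) of the S2∕S10 assembly consumes for the frozen `(f_{1u} − f_{2u}) ⊗ ⊗_{w ≠ u} f_w` (★ CARD 2
`archTensor_update_sub` gives `hf`; letter ℓ4 gives the local clause). [cite: Rogawski1990, §13.8 Prop. 13.8.3 (proof) p. 218 L20–21; §4.1 (4.1.1) p. 39] -/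
theorem isArchStablyNull_of_place
    {_hγ : ∀ γ : S10.GInf L, MeasurableSpace (S10.GInf L ⧸ Subgroup.centralizer ({γ} : Set (S10.GInf L)))}
    {_hγw : ∀ (w : {w : InfinitePlace L // w.IsComplex}) (γ : ↥(archLocal L 3 (S10.phi3 L) w)),
      MeasurableSpace (↥(archLocal L 3 (S10.phi3 L) w) ⧸ Subgroup.centralizer ({γ} : Set ↥(archLocal L 3 (S10.phi3 L) w)))}
    (mG : OrbitalMeasureFamily (S10.GInf L))
    {f : S10.GInf L → ℂ} (φ : ∀ w : {w : InfinitePlace L // w.IsComplex}, ↥(archLocal L 3 (S10.phi3 L) w) → ℂ)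
    (hf : ∀ g, f g = ∏ w, φ w (archPiEquivCM 3 L (S10.phi3 L) g w))
    (u : {w : InfinitePlace L // w.IsComplex})
    (hu : ∀ γ : S10.GInf L, IsRegularElt (γ.val : GL (Fin 3) (mixedEmbedding.mixedSpace L)) →
      ∃ mLoc : ∀ w : {w : InfinitePlace L // w.IsComplex}, OrbitalMeasureFamily ↥(archLocal L 3 (S10.phi3 L) w),
        IsArchProductFamily (S10.phi3 L)
            (fun γ' : S10.GInf L =>
              IsStablyConj (conjMixed (↥(maximalRealSubfield L)) L (IsCMField.complexConj L)) (archFormOf L 3 (S10.phi3 L)) γ' γ)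
            mG mLoc ∧
          archLocalStableOrbitalIntegral L (S10.phi3 L) u (mLoc u) (φ u) (archPiEquivCM 3 L (S10.phi3 L) γ u) = 0) :
    S10.IsArchStablyNull L mG f := by
  intro γ hγ
  obtain ⟨mLoc, hm, h0⟩ := hu γ hγ
  rw [archStableOrbitalIntegral_eq_prod L (S10.phi3 L) hm hf γ fun _ h => h]
  exact Finset.prod_eq_zero (Finset.mem_univ u) h0

end Block

end Summit.HodgeConjecture.HodgeConjecture.R90.S2

end
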